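import Literature.NumberTheory.Transcendental.ManyCurveNumericsG
import Summits.KontsevichZagierPeriods.KontsevichZagierPeriods.Theorems.SymplecticScissorsRealOnePeriodRelationsStubFamInductionOfEngine
import Summits.KontsevichZagierPeriods.KontsevichZagierPeriods.Theorems.SymplecticScissorsRealOnePeriodRelationsMultiEllLayerFamStd
import HarnessLib

/-!
# Crux `RealOnePeriodRelations` (stmt-KontsevichZagierPeriods-10042), line `nash-retraction-thin-strip`, reshape 8:
# the family Baker engine at reduced algebraic points (stub `stub_famEngineAtReduced`), the DISCHARGE of
# `semistabilityTheorem_famStd`, and the UNCONDITIONAL multi-curve open-path layer of the crux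

The registered XL stub of reshape 8: for a lattice family with algebraic invariants, every family standard
model `M = 𝔾ₘ^β × P`, every `ℚ̄`-rational proper `𝔟` with `0 < dim 𝔟`, every REDUCED algebraic point
`w ∈ 𝔟 ∩ Alg(M)` (each `E`-coordinate a vector of `Λ_{cls b}` or without torsion) and every `c > 0`, Baker's
method produces a form `P` of degree `D ≥ 1` in the theta functions of `M` with `F_P ≢ 0`, vanishing to order
`≥ nT + 1` along `𝔟` at `s·w` for `s ≤ nS` (`S ≥ 1`), whose parameters beat `c` in the zero-estimate numerics.
It is the theorem `GaGmEFam.Std.engine_of_reduced` of `Literature/NumberTheory/Transcendental/ManyCurveNumericsG.lean`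
— the family port (`ManyCurveBakerG`, `ManyCurveSiegelG`, `ManyCurveEngineG`, `ManyCurveNumericsG`) of the
one-lattice general-point chain `BakerFieldG → BakerSiegelG → ThetaBaseLowerBoundG → BakerNewPointsG →
BakerNumericsG → SemistabilityStdOfPhilippon.engine_of_reduced` — repackaged in the registered quantifier order
(the extra hypothesis `Semistable` is not used by the engine).

Then the two assembly theorems of reshape 8:

* **`semistabilityTheorem_famStd_holds`** — Baker–Wüstholz's Semistability Theorem (Thm. 6.15) for the FAMILY standard
  models `M = 𝔾ₘ^β × P` at ALL algebraic points, i.e. the Literature named fact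
  `Literature.NumberTheory.Transcendental.semistabilityTheorem_famStd`, PROVED: the landed induction over borderline
  quotients and subgroups with the stable case from an engine output (`stub_famInductionOfEngine`, with
  `stub_famDichotomyOfEngine`, `stub_famPointsAlg`, `stub_famSubAlg`, `QuotData.Φ_mem_Alg`, Philippon's zero estimate
  `philippon_family` and the second run `GaGmEFam.Std.torsionDichotomy`) applied to the engine `stub_famEngineAtReduced`;
* **`realOnePeriodRelations_multiIsoLayer`** — THE MULTI-CURVE OPEN-PATH LAYER OF THE CRUX, UNCONDITIONALLY: every
  `ℤ`-combination with vanishing value of rational representations, first/second-kind real abelian integrals with algebraic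
  end points and convergent first-kind tails on ANY finite family of real non-CM Weierstrass curves `y² = x³ + A_j x + B_j`
  over `ℚ̄ ∩ ℝ` (lattices isogenous into pairwise non-isogenous non-CM `M_i`) lies in `M₁ = closure (1a ∪ 1b ∪ 2 ∪ Green)` —
  `realOnePeriodRelations_multiIsoLayer_of_famStd semistabilityTheorem_famStd_holds`.  With it the tree proves
  Huber–Wüstholz 13.3 (2) in Kontsevich–Zagier's real clothes for arbitrary paths on every finite family of non-CM elliptic
  curves together with the punctured lines, `𝔾ₘ` and `𝔸¹`.

References: A. Baker, G. Wüstholz, *Logarithmic Forms and Diophantine Geometry* (CUP 2007), Thm. 6.15, §6.8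
(pp. 116–119); A. Baker, *Transcendental Number Theory* (CUP 1975), Ch. 2.
-/

noncomputable section

open Complex Module Submodule
open Literature.NumberTheory.Transcendental

namespace Summit.KontsevichZagierPeriods.SymplecticScissors.RealOnePeriodRelations.MultiEllLayer

/-- **STUB `stub_famEngineAtReduced` — the family Baker engine at reduced algebraic points** (the output of
Baker's method on a family standard model at the multiples of a reduced algebraic point, beating any constant
`c > 0` in the zero-estimate numerics): `GaGmEFam.Std.engine_of_reduced` in the registered quantifier order.
[cite: BakerWustholz2007, §6.8 (pp. 116–119)] [cite: BakerTNT1975, Ch. 2] -/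
theorem stub_famEngineAtReduced {J : Type} [Fintype J] [DecidableEq J] (L : J → PeriodPair)
    (hL : ∀ i, IsAlgebraic ℚ (L i).g₂ ∧ IsAlgebraic ℚ (L i).g₃) :
    ∀ (β γ δ : Type) [Fintype β] [Fintype γ] [Fintype δ] [DecidableEq γ] (cls : γ → J)
      (κM : δ → γ → GaGmE.Kbar) (𝔟 : Submodule ℂ (β ⊕ (γ ⊕ δ) → ℂ)),
      LiePresentation.IsKRational GaGmE.Kbar 𝔟 → 𝔟 ≠ ⊤ → GaGmEFam.Std.Semistable cls κM 𝔟 →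
      ∀ w ∈ 𝔟, w ∈ GaGmEFam.Std.Alg L cls κM →
      (∀ b, w (GaGmE.Std.iz b) ∈ (L (cls b)).lattice ∨
        ∀ s : ℕ, s ≠ 0 → (s : ℂ) * w (GaGmE.Std.iz b) ∉ (L (cls b)).lattice) →
      0 < Module.finrank ℂ 𝔟 → ∀ c : ℝ, 0 < c →
      ∃ (D S T : ℕ) (P : MvPolynomial (Option β × GaGmE.Std.ThetaIdx γ δ) ℂ), 1 ≤ D ∧ 1 ≤ S ∧
        P.IsHomogeneous D ∧ (∃ w', GaGmEFam.Std.thetaEval L cls κM P w' ≠ 0) ∧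
        (∀ s : ℕ, s ≤ Fintype.card (β ⊕ (γ ⊕ δ)) * S →
          GaGmE.Std.VanishesAlong 𝔟 (GaGmEFam.Std.thetaEval L cls κM P) ((s : ℂ) • w) (Fintype.card (β ⊕ (γ ⊕ δ)) * T + 1)) ∧
        ∀ e m : ℕ, m < Fintype.card (β ⊕ (γ ⊕ δ)) →
          Module.finrank ℂ 𝔟 * (Fintype.card (β ⊕ (γ ⊕ δ)) - m) ≤ e * Fintype.card (β ⊕ (γ ⊕ δ)) →
          c * (D : ℝ) ^ Fintype.card (β ⊕ (γ ⊕ δ)) < (Nat.choose (T + e) e : ℝ) * ((S : ℝ) + 1) * (D : ℝ) ^ m ∧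
          (Module.finrank ℂ 𝔟 * (Fintype.card (β ⊕ (γ ⊕ δ)) - m) < e * Fintype.card (β ⊕ (γ ⊕ δ)) →
            c * (D : ℝ) ^ Fintype.card (β ⊕ (γ ⊕ δ)) < (Nat.choose (T + e) e : ℝ) * (D : ℝ) ^ m) := by
  intro β γ δ _ _ _ _ cls κM 𝔟 hrat h𝔟 _ w hw𝔟 hw hred _ c hc
  classical
  exact GaGmEFam.Std.engine_of_reduced L cls hL κM hrat h𝔟 hw𝔟 hw hred hc

/-- **Baker–Wüstholz's Semistability Theorem (Thm. 6.15) for the family standard models at ALL algebraic points —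
the named fact `semistabilityTheorem_famStd`, PROVED** (`stub_famInductionOfEngine` ∘ `stub_famEngineAtReduced`).
[cite: BakerWustholz2007, Thm. 6.15, §6.8 (pp. 115–119)] [cite: Philippon1986, Thm 2.1] -/
theorem semistabilityTheorem_famStd_holds : Literature.NumberTheory.Transcendental.semistabilityTheorem_famStd :=
  fun _ _ _ L hL hiso β γ δ _ _ _ cls hcm1 κM 𝔟 hrat h𝔟 hss w hw𝔟 hw =>
    stub_famInductionOfEngine L hL hiso (stub_famEngineAtReduced L hL) _ β γ δ cls hcm1 κM 𝔟 rfl hrat h𝔟 hss w hw𝔟 hw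

/-- **THE MULTI-CURVE OPEN-PATH LAYER OF THE CRUX, UNCONDITIONALLY.**  Let `M_i` (`i ∈ J`, finite) be pairwise
non-isogenous lattices with algebraic invariants and without complex multiplication, and let `E_j : y² = x³ + A_j x + B_j`
(`j ∈ ι`, `A_j, B_j` real algebraic) be real Weierstrass curves whose lattices `L_j` map by algebraic isogenies `z ↦ α_j z`
into `M_{κ j}`.  Every `ℤ`-combination with vanishing value of rational representations, first/second-kind real abelian
integrals on the `E_j` (integrand `P₁ + P₂√f_j + P₃/√f_j` on an interval of positivity of `f_j` with algebraic end points) and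
convergent tails `c₀/√f_j` on `(M′, ∞)` lies in `M₁ = closure (1a ∪ 1b ∪ 2 ∪ Green)`:
`realOnePeriodRelations_multiIsoLayer_of_famStd semistabilityTheorem_famStd_holds`.
[cite: HuberWustholz2022, Thm 13.3 (2), §13.2, Ch. 15] [cite: BakerWustholz2007, Thm 6.15] [cite: KontsevichZagier2001, §1.2] -/
theorem realOnePeriodRelations_multiIsoLayer : ∀ {ι J : Type} [Fintype J] [DecidableEq J]
    (A B : ι → ℝ), (∀ j, IsAlgebraic ℚ (A j)) → (∀ j, IsAlgebraic ℚ (B j)) →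
    ∀ (M : J → PeriodPair), (∀ i, IsAlgebraic ℚ (M i).g₂ ∧ IsAlgebraic ℚ (M i).g₃) →
    (∀ i j, i ≠ j → ¬ (M i).IsIsogenousTo (M j)) → (∀ i, ¬ (M i).HasCM) →
    ∀ (L : ι → PeriodPair) (κ : ι → J) (α : ι → ℂ), (∀ j, (L j).g₂ = -4 * (A j : ℂ)) → (∀ j, (L j).g₃ = -4 * (B j : ℂ)) →
    (∀ j, α j ≠ 0) → (∀ j, IsAlgebraic ℚ (α j)) → (∀ j, ∀ l ∈ (L j).lattice, α j * l ∈ (M (κ j)).lattice) →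
    ∀ c : KZ.FormalRep, c ∈ AddSubgroup.closure ((fun r : KZ.IntegralRep 1 => KZ.of r) ''
      {r | r.IsRational ∨
        (∃ j, ∃ a b : ℝ, IsAlgebraic ℚ a ∧ IsAlgebraic ℚ b ∧ a < b ∧ r.domain = {z | z 0 ∈ Set.Ioo a b} ∧
          (∀ x ∈ Set.Ioo a b, 0 < x ^ 3 + A j * x + B j) ∧
          ∃ P₁ P₂ P₃ : Polynomial (algebraicClosure ℚ ℝ), ∀ x ∈ Set.Ioo a b,
            r.integrand (fun _ => x) = Polynomial.aeval x P₁ + Polynomial.aeval x P₂ * Real.sqrt (x ^ 3 + A j * x + B j) +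
              Polynomial.aeval x P₃ / Real.sqrt (x ^ 3 + A j * x + B j)) ∨
        (∃ j, ∃ e M c₀ : ℝ, IsAlgebraic ℚ e ∧ IsAlgebraic ℚ M ∧ IsAlgebraic ℚ c₀ ∧ e ^ 3 + A j * e + B j = 0 ∧
          0 < 3 * e ^ 2 + A j ∧ e < M ∧ (∀ x : ℝ, e < x → 0 < x ^ 3 + A j * x + B j) ∧ r.domain = {z | M < z 0} ∧
          ∀ z ∈ r.domain, r.integrand z = c₀ / Real.sqrt ((z 0) ^ 3 + A j * (z 0) + B j))}) →
    KZ.eval c = 0 →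
    c ∈ AddSubgroup.closure (KZ.domainAddRel ∪ KZ.integrandAddRel ∪ KZ.changeOfVariablesRel ∪
      {g : KZ.FormalRep | ∃ (Δ : Set (Fin 2 → ℝ)) (A B S : (Fin 2 → ℝ) → ℝ) (r₀₁ r₁₂ r₀₂ : KZ.IntegralRep 1),
        Δ = {p | 0 ≤ p 0 ∧ 0 ≤ p 1 ∧ p 0 + p 1 ≤ 1} ∧ IsSemialgebraicFunOn ℚ Δ A ∧ IsSemialgebraicFunOn ℚ Δ B ∧
        ContinuousOn A Δ ∧ ContinuousOn B Δ ∧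
        (∀ p : Fin 2 → ℝ, 0 < p 0 → 0 < p 1 → p 0 + p 1 < 1 →
          HasFDerivAt S (A p • ContinuousLinearMap.proj (R := ℝ) (φ := fun _ : Fin 2 => ℝ) 0 +
            B p • ContinuousLinearMap.proj (R := ℝ) (φ := fun _ : Fin 2 => ℝ) 1) p) ∧
        r₀₁.domain = {z | z 0 ∈ Set.Ioo 0 1} ∧ r₁₂.domain = {z | z 0 ∈ Set.Ioo 0 1} ∧
        r₀₂.domain = {z | z 0 ∈ Set.Ioo 0 1} ∧ (∀ z ∈ r₀₁.domain, r₀₁.integrand z = A ![z 0, 0]) ∧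
        (∀ z ∈ r₁₂.domain, r₁₂.integrand z = B ![1 - z 0, z 0] - A ![1 - z 0, z 0]) ∧
        (∀ z ∈ r₀₂.domain, r₀₂.integrand z = B ![0, z 0]) ∧ g = KZ.of r₀₁ + KZ.of r₁₂ - KZ.of r₀₂}) :=
  realOnePeriodRelations_multiIsoLayer_of_famStd semistabilityTheorem_famStd_holds

end Summit.KontsevichZagierPeriods.SymplecticScissors.RealOnePeriodRelations.MultiEllLayer

end
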